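import Summits.QuantumFields.YangMills.Theorems.BalabanUVNodesPortS1JacobianHoloPrivate
import Summits.QuantumFields.YangMills.Theorems.BalabanUVNodesN07CentralResponseNormalForm

/-!
# NODE O port PT-A — THE HOLOMORPHIC CENTRAL RESPONSE IN NORMAL FORM AND ITS (0.8) ESTIMATE, COMPLEX EDITION: for an `SL(2,ℂ)`-valued bond-matrix field `W` with (0.4) loop matrices in the
# polydisc and a traceless direction `X` at the central bond `β(c)`,  `D_ℂ avgMh(W)[X·W(β)·δ_β](c) = D eml(loops)[i ↦ central ? 0 : −loop_i·X̃]·axial + eml(loops)·X̃·axial`,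
# `X̃ = pre·X·adj pre`, and  `‖D_ℂ avgMh(W)[X·W(β)·δ_β](c)·adj(axial) − (N_c∕|I|)·X̃‖ ≤ 314·α·‖X̃‖`  when the non-central loop matrices at `c` are within `α ≤ 1∕24` of `1` — the complex
# edition of dag-n07-w2's `N07CentralResponseNormalForm.norm_centralResponse_sub_le` «with `W₀⁻¹` for `W₀⋆`» that PORT-PLAN-v5 §4 (a)(b) asks for on the whole complex domain

Cell `ym-nodeO-ideate`, porter seat `ymgap-nodeO-port-PTZ-1` (gen 6) as STUB-WORKER under the `stub_LZjac` line of 27930's skeleton `pta_residueW` (director-ym №522 (2): item (3) of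
▶ PTA-1 g5's gen-6 list); `--supports stmt-QuantumFields-27930` (helper), NO `--workitem`.  [I] = [Balaban1987RG1], [B7] = [Balaban1985Averaging], [15] = [Balaban1985Variational].
FILE (B) of three (file (A) `…JacobianHoloPrivate`: the private-coordinate bookkeeping; file (C) `…JacobianHoloDomainDet`: `det A₁^ℂ(c)` near `(N_c∕|I|)³`, slit plane, analyticity).
CONSUMED BY NAME, nothing modified: file (A); `B15AveragingHolomorphic` (`avgMh = corrMh · axialMh`, `differentiableAt_avgMh`); `ExpMeanLog.differentiableAt_eml`; ✓p812756 `…JacobianHoloSL2`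
(`det_holMh_eq_one`, `det_update_exp_mul` — PTA-1's single-bond exponential curve `t ↦ W[β ↦ e^{tX}W(β)]`, stays `SL(2,ℂ)`-valued); ✓p812449 `…JacobianHolo` (`adjugate_eq_trace_smul_one_sub`);
dag-n07-w2's `N07CentralResponseNormalForm.norm_centralResponse_sub_le` ([B7] (0.8): `‖D eml − mean‖ ≤ 144‖F₀ − 1‖`, `‖eml − 1‖ ≤ 6α`; constant `157`); Mathlib's `hasFDerivAt_exp_zero`,
`HasDerivAt.unique`, `Matrix.adjugate_mul_distrib`, `norm_star`, `module`.
WHY.  The `b₀`-block `A₁^ℂ(c)(W)` of `stub_LZjac`'s holomorphic Jacobian factor (✓p812392 `jacBlockC`) reads the response `D_ℂ avgMh(W)[su2Gen a·W(β)·δ_β](c)·(avgMh W c)⁻¹`.  In the private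
coordinate `g = W(β(c))` the holomorphic average is the one-variable map `g ↦ eml(i ↦ central ? 1 : open_i·adj(pre·g·post))·(pre·g·post)` (file (A): central loops are `1`, the others factor
through the open products, which do not read `g`); differentiating along the det-one curve `g(t) = e^{tX}W(β)` (`adj` is linear on `M₂(ℂ)`, `adj X = −X` for traceless `X`, `adj pre·pre = 1`)
gives the normal form of §3, which is LETTER FOR LETTER the unitary normal form of dag-n07-w2 with `⋆ ↦ adj`; the (0.8) estimate then applies at `W₀ := 1` to the skew parts of any complex
direction and recombines by ℂ-linearity (§4) — so `A₁^ℂ(c)(W)` is `(N_c∕|I|)·Ad^ℂ(pre)` up to `O(α)` (file (C) draws the determinant consequence).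
* §3 `exists_clm_eq_adjugate`, ★★ `fderiv_avgMh_single_centralBond_eq` (the response in normal form).
* §4 ★ `norm_centralResponseC_sub_le` (abstract, any index set, any `N`: `‖D eml(F₀)[i ↦ cen ? 0 : −F₀(i)Y] + eml(F₀)Y − (1 − m∕|I|)Y‖ ≤ 314α‖Y‖`), `nonempty_idxP`, `one_sub_nonCentral_div_eq`
  (`1 − m∕|I| = N_c∕|I|`), ★★ `norm_response_mul_adjugate_sub_le` (the lattice statement at `c`).

HONEST FRAMING.  Kernel calculus ∕ algebra over the tree's own holomorphic model and dag-n07-w2's landed (0.8) estimate; NOTHING of Bałaban's estimates asserted, ported or discharged; this is the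
response estimate for ONE averaging step at ONE coarse bond on one torus — the road from the (1.11)–(1.16) conditions to loop smallness of `axialize(Ū^k 𝐔)`, the `axialize ∘ Ū^k` composition,
rows (c)(d) and the packaging (e) remain (PTA-1 g6 ∕ later); `stub_LZjac` OPEN; `stub_LZdet` BLOCKED-ON P0 (α)+(β); `stub_FE` XXL; 27930 OPEN · no claim; 26648 OPEN; K0⁷∕K-Ax OPEN; NODE O 0∕1;
COUNT 8∕28 · K 1∕4 UNMOVED; finite `𝕋⁴_{L^K}` at fixed ε — NOT continuum ∕ OS ∕ Clay; **the Yang–Mills mass gap is NOT proved by any of this.**  No `sorry`, no `def`, no `instance`, no `notation`;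
standard axioms.
-/

noncomputable section

open scoped BigOperators Matrix.Norms.L2Operator Topology

namespace Summit.QuantumFields.YangMills.Theorems.BalabanUVNodesPortS1

open Summit.QuantumFields.YangMills.Theorems.K0RecordFormatNames
open Literature.MathematicalPhysics.QuantumFieldTheory.Balaban1983to89
open Literature.MathematicalPhysics.QuantumFieldTheory.Balaban1983to89.Node00
open Literature.MathematicalPhysics.QuantumFieldTheory.Balaban1983to89.T4Continuum
  (T4Family LStep walk walkEnd Letter wordRev stairWord axisRun walk_append walkEnd_walkEnd_wordRev wordRev_cons walkEnd_replicate_line)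
open Literature.MathematicalPhysics.QuantumFieldTheory.Balaban1983to89.BlockAveraging (Idx off)
open Literature.MathematicalPhysics.QuantumFieldTheory.Balaban1983to89.BlockAveragingHaarAC
  (centralBond IsCentral nCentral openWord loopWord_eq_openWord_append walkEnd_openWord replicate_false_eq_wordRev wordRev_replicate_false
   stairWord_eq_axisRun_of_forall_ne central_of_mem_walk_openWord mem_walk_replicate L_dvd_of_emb_add_eq eq_zero_of_L_dvd lineSite_apply_int)
open Literature.MathematicalPhysics.QuantumFieldTheory.Balaban1983to89.AveragingRT (lineSite lineSite_succ two_mul_half_add_one)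
open Literature.MathematicalPhysics.QuantumFieldTheory.Balaban1983to89.ExpMeanLog (eml eml_eq_exp differentiableAt_eml)
open Literature.MathematicalPhysics.QuantumFieldTheory.Balaban1983to89.B15AveragingHolomorphic
open Literature.MathematicalPhysics.QuantumFieldTheory.Balaban1983to89.B15AveragingHolomorphicLocal (holMh_congr)
open _root_.Matrix _root_.Filter

variable {P : Params} {j : ℕ}

/-! ## §3  ★★ The holomorphic central response in the one-variable normal form -/

/-- The adjugate of `M₂(ℂ)` as a continuous ℝ-linear map (`adj A = tr A · 1 − A`). [folklore] -/
theorem exists_clm_eq_adjugate : ∃ T : MatA 2 →L[ℝ] MatA 2, ∀ A : MatA 2, T A = A.adjugate := by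
  refine ⟨(((LinearMap.toContinuousLinearMap (Matrix.traceLinearMap (Fin 2) ℂ ℂ)).smulRight (1 : MatA 2)) -
    ContinuousLinearMap.id ℂ (MatA 2)).restrictScalars ℝ, fun A => ?_⟩
  rw [adjugate_eq_trace_smul_one_sub]
  rfl

/-- ★★ **THE HOLOMORPHIC RESPONSE AT THE CENTRAL BOND IN NORMAL FORM.**  For an `SL(2,ℂ)`-valued field `W` whose (0.4) loop matrices lie in the polydisc `‖· − 1‖ < 1` at every coarse bond, a traceless
direction `X` at the central bond `β(c)`, `pre ∕ post` the two halves of the straight segment and `X̃ := pre·X·adj pre`: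
`D_ℂ avgMh(W)[X·W(β)·δ_β](c) = D eml(loops)[i ↦ central ? 0 : −loop_i·X̃]·axialMh W c + eml(loops)·X̃·axialMh W c` — the derivative at `t = 0` of
`t ↦ eml(i ↦ central ? 1 : open_i·adj(pre·e^{tX}W(β)·post))·(pre·e^{tX}W(β)·post)` (§2), the complex edition of dag-n07-w2's
`N07CentralResponseNormalForm.fderiv_avgM_single_centralBond_eq_normalForm` with `adj` for `⋆`. [cite: Balaban1987RG1, (0.4) p.253, p.267 («h(c)»); Balaban1985Variational, Prop. 9 p.309] -/
theorem fderiv_avgMh_single_centralBond_eq (hj : j + 1 ≤ P.m + P.K) (W : PBond P j → MatA 2) (hW : ∀ b, (W b).det = 1)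
    (hpoly : ∀ (c : PBond P (j + 1)) (i : Idx P), ‖loopMh W c i - 1‖ < 1) (c : PBond P (j + 1)) {X : MatA 2} (hX : X.trace = 0) :
    fderiv ℂ (avgMh : (PBond P j → MatA 2) → PBond P (j + 1) → MatA 2) W (Pi.single (centralBond c) (X * W (centralBond c))) c =
      fderiv ℂ (eml : (Idx P → MatA 2) → MatA 2) (fun i => loopMh W c i)
          (fun i => if IsCentral c i then 0 else
            -(loopMh W c i * (holMh W (walk (emb c.src) (List.replicate ((P.L - 1) / 2) (c.dir, true))) * X *
              (holMh W (walk (emb c.src) (List.replicate ((P.L - 1) / 2) (c.dir, true)))).adjugate))) * axialMh W c +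
        eml (fun i => loopMh W c i) *
          ((holMh W (walk (emb c.src) (List.replicate ((P.L - 1) / 2) (c.dir, true))) * X *
              (holMh W (walk (emb c.src) (List.replicate ((P.L - 1) / 2) (c.dir, true)))).adjugate) * axialMh W c) := by
  classical
  letI : NormedAlgebra ℚ (MatA 2) := NormedAlgebra.restrictScalars ℚ ℂ (MatA 2)
  set β := centralBond c with hβ
  set pre := holMh W (walk (emb c.src) (List.replicate ((P.L - 1) / 2) (c.dir, true))) with hpre
  set post := holMh W (walk (lineSite c ((P.L - 1) / 2 + 1)) (List.replicate ((P.L - 1) / 2) (c.dir, true))) with hpost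
  set opn : Idx P → MatA 2 := fun i => holMh W (walk (emb c.src) (openWord P.L c.dir (off i.1) i.2.1 i.2.2)) with hopn
  set F₀ : Idx P → MatA 2 := fun i => loopMh W c i with hF₀
  have hdpre : pre.det = 1 := det_holMh_eq_one W hW _
  -- the curve and its velocity (PTA-1's single-bond exponential curve)
  set γ : ℝ → PBond P j → MatA 2 := fun t b' => if b' = β then NormedSpace.exp (t • X) * W β else W b' with hγ
  have hγupd : ∀ t, γ t = Function.update W β (NormedSpace.exp (t • X) * W β) := fun t => by
    funext b'
    rw [Function.update_apply]
  have hγ0 : γ 0 = W := by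
    funext b'
    simp only [hγ, zero_smul, NormedSpace.exp_zero, one_mul]
    split_ifs with h
    · rw [h]
    · rfl
  have hexp : HasDerivAt (fun t : ℝ => NormedSpace.exp (t • X) * W β) (X * W β) 0 := by
    have hline : HasDerivAt (fun t : ℝ => t • X) X 0 := by simpa using (hasDerivAt_id (0 : ℝ)).smul_const X
    have he : HasFDerivAt (NormedSpace.exp : MatA 2 → MatA 2) ((1 : MatA 2 →L[ℂ] MatA 2).restrictScalars ℝ) ((fun t : ℝ => t • X) 0) := by
      have e : (fun t : ℝ => t • X) 0 = 0 := zero_smul _ _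
      rw [e]; exact (hasFDerivAt_exp_zero (𝕂 := ℂ)).restrictScalars ℝ
    exact (he.comp_hasDerivAt (0 : ℝ) hline).mul_const (W β)
  have hγd : HasDerivAt γ (Pi.single β (X * W β)) 0 := by
    refine hasDerivAt_pi.2 fun b' => ?_
    by_cases hb : b' = β
    · subst hb
      simp only [hγ, if_true, Pi.single_eq_same]
      exact hexp
    · simp only [hγ, hb, if_false, Pi.single_eq_of_ne hb]
      exact hasDerivAt_const _ _
  have hdetγ : ∀ t b, (γ t b).det = 1 := fun t b => det_update_exp_mul W hW β hX t b
  -- the (L) derivative: the holomorphic response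
  have hM : HasFDerivAt (avgMh : (PBond P j → MatA 2) → PBond P (j + 1) → MatA 2)
      ((fderiv ℂ (avgMh : (PBond P j → MatA 2) → PBond P (j + 1) → MatA 2) W).restrictScalars ℝ) (γ 0) := by
    rw [hγ0]; exact (differentiableAt_avgMh hpoly).hasFDerivAt.restrictScalars ℝ
  have hA : HasDerivAt (fun t : ℝ => avgMh (γ t) c)
      (fderiv ℂ (avgMh : (PBond P j → MatA 2) → PBond P (j + 1) → MatA 2) W (Pi.single β (X * W β)) c) 0 :=
    (hasDerivAt_pi.mp (hM.comp_hasDerivAt (0 : ℝ) hγd)) c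
  -- the normal form along the curve (§2)
  set Mx : ℝ → MatA 2 := fun t => pre * (NormedSpace.exp (t • X) * W β) * post with hMx
  set F : ℝ → Idx P → MatA 2 := fun t i => if IsCentral c i then 1 else opn i * (Mx t).adjugate with hF
  have hax : ∀ t, axialMh (γ t) c = Mx t := fun t => by
    rw [hγupd t, axialMh_update_centralBond hj]
  have hloop : ∀ t i, loopMh (γ t) c i = F t i := fun t i => by
    by_cases hc : IsCentral c i
    · simp only [hF, hc, if_true]
      exact loopMh_of_isCentral (γ t) (hdetγ t) c i hc
    · simp only [hF, hc, if_false]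
      rw [loopMh_eq_open_mul_adjugate, hax t, hγupd t, holMh_openWord_update_of_not_isCentral hj W c i hc]
  have hnf : (fun t : ℝ => avgMh (γ t) c) = fun t => eml (F t) * Mx t := by
    funext t
    show corrMh (γ t) c * axialMh (γ t) c = _
    rw [hax t]
    unfold corrMh
    rw [show (fun i : Idx P => loopMh (γ t) c i) = F t from funext (hloop t)]
  have hF0 : F 0 = F₀ := by
    funext i; rw [← hloop 0 i, hγ0]
  have hMx0 : Mx 0 = axialMh W c := by rw [← hax 0, hγ0]
  -- the (R) derivative: normal form calculus
  have hMxd : HasDerivAt Mx (pre * (X * W β) * post) 0 := (hexp.const_mul pre).mul_const post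
  obtain ⟨T, hT⟩ := exists_clm_eq_adjugate
  have hadjd : HasDerivAt (fun t => (Mx t).adjugate) ((pre * (X * W β) * post).adjugate) 0 := by
    have h := T.hasFDerivAt.comp_hasDerivAt (0 : ℝ) hMxd
    rw [hT] at h
    refine h.congr_of_eventuallyEq (Filter.Eventually.of_forall fun t => ?_)
    exact (hT (Mx t)).symm
  have hFd : HasDerivAt F (fun i => if IsCentral c i then (0 : MatA 2) else opn i * (pre * (X * W β) * post).adjugate) 0 := by
    refine hasDerivAt_pi.2 fun i => ?_
    by_cases hc : IsCentral c i
    · simp only [hF, hc, if_true]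
      exact hasDerivAt_const _ _
    · simp only [hF, hc, if_false]
      exact hadjd.const_mul (opn i)
  have heml : HasFDerivAt (eml : (Idx P → MatA 2) → MatA 2)
      ((fderiv ℂ (eml : (Idx P → MatA 2) → MatA 2) F₀).restrictScalars ℝ) (F 0) := by
    rw [hF0]; exact (differentiableAt_eml (hpoly c)).hasFDerivAt.restrictScalars ℝ
  have hB : HasDerivAt (fun t : ℝ => eml (F t) * Mx t)
      (fderiv ℂ (eml : (Idx P → MatA 2) → MatA 2) F₀ (fun i => if IsCentral c i then (0 : MatA 2) else opn i * (pre * (X * W β) * post).adjugate) * Mx 0 +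
        eml (F 0) * (pre * (X * W β) * post)) 0 :=
    (heml.comp_hasDerivAt (0 : ℝ) hFd).mul hMxd
  rw [hnf] at hA
  have huniq := hA.unique hB
  rw [huniq, hF0, hMx0]
  -- algebra: `adj(pre·X·W(β)·post) = −adj post·adj W(β)·X·adj pre`, `open_i·adj post·adj W(β) = loop_i·pre`
  have hadjX : X.adjugate = -X := by rw [adjugate_eq_trace_smul_one_sub, hX, zero_smul, zero_sub]
  have hkey : ∀ i, ¬ IsCentral c i → opn i * (pre * (X * W β) * post).adjugate = -(F₀ i * (pre * X * pre.adjugate)) := by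
    intro i hc
    have hFi : F₀ i = opn i * (post.adjugate * (W β).adjugate * pre.adjugate) := by
      simp only [hF₀]
      rw [loopMh_eq_open_mul_adjugate, axialMh_eq_pre_mul_mul_post, Matrix.adjugate_mul_distrib, Matrix.adjugate_mul_distrib, mul_assoc]
    rw [hFi, Matrix.adjugate_mul_distrib, Matrix.adjugate_mul_distrib, Matrix.adjugate_mul_distrib, hadjX]
    calc opn i * (post.adjugate * ((W β).adjugate * -X * pre.adjugate))
        = -(opn i * post.adjugate * (W β).adjugate * (pre.adjugate * pre) * X * pre.adjugate) := by
          rw [adjugate_mul_self_of_det_eq_one hdpre]; noncomm_ring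
      _ = -(opn i * (post.adjugate * (W β).adjugate * pre.adjugate) * (pre * X * pre.adjugate)) := by noncomm_ring
  have hdir : (fun i => if IsCentral c i then (0 : MatA 2) else opn i * (pre * (X * W β) * post).adjugate) =
      fun i => if IsCentral c i then 0 else -(F₀ i * (pre * X * pre.adjugate)) := by
    funext i
    by_cases hc : IsCentral c i
    · simp only [hc, if_true]
    · simp only [hc, if_false]; exact hkey i hc
  have hsec : pre * (X * W β) * post = pre * X * pre.adjugate * axialMh W c := by
    rw [axialMh_eq_pre_mul_mul_post]
    calc pre * (X * W β) * post = pre * X * (pre.adjugate * pre) * W β * post := by rw [adjugate_mul_self_of_det_eq_one hdpre]; noncomm_ring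
      _ = _ := by noncomm_ring
  rw [hdir, hsec]


/-! ## §4  ★★ The estimate: the response is `(N_c∕|I|)·X̃ + O(α)·X̃` — dag-n07-w2's (0.8) estimate, complex edition -/

section Abstract

variable {ι : Type*} [Fintype ι] [Nonempty ι] {N : ℕ} [NeZero N]

/-- ★ **THE (0.8) CENTRAL-RESPONSE ESTIMATE, COMPLEX EDITION**: for a family `F₀` equal to `1` at the central indices and within `α ≤ 1∕24` of `1` at the `m` non-central ones, and ANY
matrix `Y`, `‖D eml(F₀)[i ↦ central ? 0 : −F₀(i)·Y] + eml(F₀)·Y − (1 − m∕|I|)·Y‖ ≤ 314·α·‖Y‖` — dag-n07-w2's `N07CentralResponseNormalForm.norm_centralResponse_sub_le` (unitary edition, skew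
directions, constant `157`) at `W₀ := 1`, extended to all of `M_N(ℂ)` by ℂ-linearity through `Y = ½(Y − Y⋆) + i·(−i∕2)(Y + Y⋆)`. [cite: Balaban1987RG1, (0.8) p.253; Balaban1985Averaging, Prop. 3 (124) p.36] -/
theorem norm_centralResponseC_sub_le (cen : ι → Prop) [DecidablePred cen] (F₀ : ι → Matrix (Fin N) (Fin N) ℂ) (hcen : ∀ i, cen i → F₀ i = 1)
    {α : ℝ} (hα0 : 0 ≤ α) (hα : α ≤ 1 / 24) (hF : ∀ i, ¬ cen i → ‖F₀ i - 1‖ ≤ α) (Y : Matrix (Fin N) (Fin N) ℂ) :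
    ‖fderiv ℂ (eml : (ι → Matrix (Fin N) (Fin N) ℂ) → Matrix (Fin N) (Fin N) ℂ) F₀ (fun i => if cen i then 0 else -(F₀ i * Y)) + eml F₀ * Y - Y +
        (((Finset.univ.filter fun i => ¬ cen i).card : ℂ) / (Fintype.card ι : ℂ)) • Y‖ ≤ 314 * α * ‖Y‖ := by
  set D := fderiv ℂ (eml : (ι → Matrix (Fin N) (Fin N) ℂ) → Matrix (Fin N) (Fin N) ℂ) F₀ with hD
  set q : ℂ := ((Finset.univ.filter fun i => ¬ cen i).card : ℂ) / (Fintype.card ι : ℂ) with hq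
  -- the ℂ-linear map `G` and its direction family `H`
  set H : Matrix (Fin N) (Fin N) ℂ → ι → Matrix (Fin N) (Fin N) ℂ := fun Z i => if cen i then 0 else -(F₀ i * Z) with hH
  set G : Matrix (Fin N) (Fin N) ℂ → Matrix (Fin N) (Fin N) ℂ := fun Z => D (H Z) + eml F₀ * Z - Z + q • Z with hG
  -- (1) skew directions: the unitary edition at `W₀ := 1`
  have hskew : ∀ X : Matrix (Fin N) (Fin N) ℂ, star X = -X → ‖G X‖ ≤ 157 * α * ‖X‖ := by
    intro X hX
    have hF₀' : (fun i => if cen i then (1 : Matrix (Fin N) (Fin N) ℂ) else F₀ i * star (1 : Matrix (Fin N) (Fin N) ℂ)) = F₀ := by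
      funext i
      by_cases hc : cen i
      · rw [if_pos hc, hcen i hc]
      · rw [if_neg hc, star_one, mul_one]
    have hH' : (fun i => if cen i then (0 : Matrix (Fin N) (Fin N) ℂ) else F₀ i * star (X * 1)) = H X := by
      funext i
      by_cases hc : cen i
      · simp only [hH, hc, if_true]
      · simp only [hH, hc, if_false, mul_one, hX, mul_neg]
    have h := Summit.QuantumFields.YangMills.BalabanUVNodes.N07CentralResponseNormalForm.norm_centralResponse_sub_le cen F₀ 1 X hα0 hα
      (fun i hc => by rw [star_one, mul_one]; exact hF i hc) (by rw [star_one, mul_one]) hX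
    rw [hF₀', hH', star_one, mul_one, mul_one, mul_one] at h
    exact h
  -- (2) the skew decomposition `Y = Y₁ + i·Y₂`
  set Y₁ : Matrix (Fin N) (Fin N) ℂ := (2 : ℂ)⁻¹ • (Y - star Y) with hY₁
  set Y₂ : Matrix (Fin N) (Fin N) ℂ := (-(Complex.I) / 2) • (Y + star Y) with hY₂
  have hY₁s : star Y₁ = -Y₁ := by
    have hs2 : star ((2 : ℂ)⁻¹) = (2 : ℂ)⁻¹ := by simp
    simp only [hY₁, star_smul, star_sub, star_star, hs2]
    rw [← smul_neg, neg_sub]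
  have hY₂s : star Y₂ = -Y₂ := by
    have hs2 : star (-(Complex.I) / 2) = Complex.I / 2 := by simp [Complex.conj_I]
    simp only [hY₂, star_smul, star_add, star_star, hs2]
    rw [← neg_smul]
    congr 1
    · ring
    · exact add_comm _ _
  have hYdec : Y = Y₁ + Complex.I • Y₂ := by
    simp only [hY₁, hY₂, smul_smul]
    rw [show Complex.I * (-(Complex.I) / 2) = (2 : ℂ)⁻¹ by
      rw [mul_div_assoc', mul_neg, Complex.I_mul_I, neg_neg]; norm_num]
    rw [smul_sub, smul_add]
    have h2 : ((2 : ℂ)⁻¹ • Y + (2 : ℂ)⁻¹ • Y : Matrix (Fin N) (Fin N) ℂ) = Y := by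
      rw [← add_smul]; norm_num
    calc Y = (2 : ℂ)⁻¹ • Y + (2 : ℂ)⁻¹ • Y := h2.symm
      _ = _ := by abel
  -- (3) norms of the parts
  have h2n : ‖(2 : ℂ)⁻¹‖ = 2⁻¹ := by simp
  have hI2n : ‖(-(Complex.I) / 2 : ℂ)‖ = 2⁻¹ := by simp
  have hn₁ : ‖Y₁‖ ≤ ‖Y‖ := by
    calc ‖Y₁‖ ≤ ‖(2 : ℂ)⁻¹‖ * ‖Y - star Y‖ := norm_smul_le _ _
      _ ≤ ‖(2 : ℂ)⁻¹‖ * (‖Y‖ + ‖star Y‖) := by gcongr; exact norm_sub_le _ _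
      _ = ‖Y‖ := by rw [norm_star, h2n]; ring
  have hn₂ : ‖Y₂‖ ≤ ‖Y‖ := by
    calc ‖Y₂‖ ≤ ‖(-(Complex.I) / 2 : ℂ)‖ * ‖Y + star Y‖ := norm_smul_le _ _
      _ ≤ ‖(-(Complex.I) / 2 : ℂ)‖ * (‖Y‖ + ‖star Y‖) := by gcongr; exact norm_add_le _ _
      _ = ‖Y‖ := by rw [norm_star, hI2n]; ring
  clear_value Y₁ Y₂
  -- (4) ℂ-linearity of `G`
  have hHlin : H Y = H Y₁ + Complex.I • H Y₂ := by
    funext i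
    by_cases hc : cen i
    · simp only [hH, hc, if_true, Pi.add_apply, Pi.smul_apply, smul_zero, add_zero]
    · simp only [hH, hc, if_false, Pi.add_apply, Pi.smul_apply]
      rw [hYdec, mul_add, mul_smul_comm, neg_add, smul_neg]
  have hEml : eml F₀ * Y = eml F₀ * Y₁ + Complex.I • (eml F₀ * Y₂) := by rw [hYdec, mul_add, mul_smul_comm]
  have hGlin : G Y = G Y₁ + Complex.I • G Y₂ := by
    simp only [hG]
    rw [hHlin, map_add, map_smul, hEml]
    rw [hYdec]
    module
  have hGY : G Y = D (H Y) + eml F₀ * Y - Y + q • Y := rfl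
  rw [← hGY, hGlin]
  calc ‖G Y₁ + Complex.I • G Y₂‖ ≤ ‖G Y₁‖ + ‖Complex.I • G Y₂‖ := norm_add_le _ _
    _ = ‖G Y₁‖ + ‖G Y₂‖ := by rw [norm_smul, Complex.norm_I, one_mul]
    _ ≤ 157 * α * ‖Y₁‖ + 157 * α * ‖Y₂‖ := add_le_add (hskew Y₁ hY₁s) (hskew Y₂ hY₂s)
    _ ≤ 157 * α * ‖Y‖ + 157 * α * ‖Y‖ := by gcongr
    _ = 314 * α * ‖Y‖ := by ring

end Abstract

/-- `Idx P` is inhabited (the zero offset with the identity orderings). [folklore] -/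
theorem nonempty_idxP : Nonempty (Idx P) := ⟨(fun _ => ⟨0, P.L_pos⟩, 1, 1)⟩

/-- `1 − m∕|I| = N_c∕|I|` (`m` non-central, `N_c` central indices). [folklore] -/
theorem one_sub_nonCentral_div_eq (c : PBond P (j + 1)) :
    (1 : ℂ) - ((Finset.univ.filter fun i : Idx P => ¬ IsCentral c i).card : ℂ) / (Fintype.card (Idx P) : ℂ) =
      (nCentral c : ℂ) / (Fintype.card (Idx P) : ℂ) := by
  haveI := nonempty_idxP (P := P)
  have hcard : (Fintype.card (Idx P) : ℂ) ≠ 0 := by exact_mod_cast Fintype.card_pos.ne'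
  have hsum : ((Finset.univ.filter fun i : Idx P => IsCentral c i).card : ℂ) + ((Finset.univ.filter fun i : Idx P => ¬ IsCentral c i).card : ℂ) =
      (Fintype.card (Idx P) : ℂ) := by
    exact_mod_cast Finset.card_filter_add_card_filter_not (s := (Finset.univ : Finset (Idx P))) (p := IsCentral c)
  rw [nCentral, eq_div_iff hcard, sub_mul, div_mul_cancel₀ _ hcard, one_mul, ← hsum]
  ring

/-- ★★ **THE HOLOMORPHIC CENTRAL RESPONSE IS `(N_c∕|I|)·X̃ + O(α)·X̃`** (`X̃ = pre·X·adj pre`): for an `SL(2,ℂ)`-valued `W` with loop matrices in the polydisc everywhere and within `α ≤ 1∕24` of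
`1` at the non-central indices of `c`, and a traceless `X`,
`‖D_ℂ avgMh(W)[X·W(β)·δ_β](c) · adj(axialMh W c) − (N_c∕|I|)·X̃‖ ≤ 314·α·‖X̃‖`. [cite: Balaban1987RG1, (0.8) p.253, p.267 («h(c)»); Balaban1985Averaging, Prop. 3 (124) p.36] -/
theorem norm_response_mul_adjugate_sub_le (hj : j + 1 ≤ P.m + P.K) (W : PBond P j → MatA 2) (hW : ∀ b, (W b).det = 1)
    (hpoly : ∀ (c : PBond P (j + 1)) (i : Idx P), ‖loopMh W c i - 1‖ < 1) (c : PBond P (j + 1)) {X : MatA 2} (hX : X.trace = 0)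
    {α : ℝ} (hα0 : 0 ≤ α) (hα : α ≤ 1 / 24) (hloop : ∀ i, ¬ IsCentral c i → ‖loopMh W c i - 1‖ ≤ α) :
    ‖fderiv ℂ (avgMh : (PBond P j → MatA 2) → PBond P (j + 1) → MatA 2) W (Pi.single (centralBond c) (X * W (centralBond c))) c *
          (axialMh W c).adjugate -
        ((nCentral c : ℂ) / (Fintype.card (Idx P) : ℂ)) •
          (holMh W (walk (emb c.src) (List.replicate ((P.L - 1) / 2) (c.dir, true))) * X *
            (holMh W (walk (emb c.src) (List.replicate ((P.L - 1) / 2) (c.dir, true)))).adjugate)‖ ≤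
      314 * α * ‖holMh W (walk (emb c.src) (List.replicate ((P.L - 1) / 2) (c.dir, true))) * X *
            (holMh W (walk (emb c.src) (List.replicate ((P.L - 1) / 2) (c.dir, true)))).adjugate‖ := by
  classical
  haveI := nonempty_idxP (P := P)
  set Y := holMh W (walk (emb c.src) (List.replicate ((P.L - 1) / 2) (c.dir, true))) * X *
    (holMh W (walk (emb c.src) (List.replicate ((P.L - 1) / 2) (c.dir, true)))).adjugate with hY
  have hA : axialMh W c * (axialMh W c).adjugate = 1 := self_mul_adjugate_of_det_eq_one (det_holMh_eq_one W hW _)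
  rw [fderiv_avgMh_single_centralBond_eq hj W hW hpoly c hX]
  have e : (fderiv ℂ (eml : (Idx P → MatA 2) → MatA 2) (fun i => loopMh W c i) (fun i => if IsCentral c i then 0 else -(loopMh W c i * Y)) * axialMh W c +
        eml (fun i => loopMh W c i) * (Y * axialMh W c)) * (axialMh W c).adjugate -
        ((nCentral c : ℂ) / (Fintype.card (Idx P) : ℂ)) • Y =
      fderiv ℂ (eml : (Idx P → MatA 2) → MatA 2) (fun i => loopMh W c i) (fun i => if IsCentral c i then 0 else -(loopMh W c i * Y)) +
        eml (fun i => loopMh W c i) * Y - Y +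
          (((Finset.univ.filter fun i : Idx P => ¬ IsCentral c i).card : ℂ) / (Fintype.card (Idx P) : ℂ)) • Y := by
    rw [← one_sub_nonCentral_div_eq c, sub_smul, one_smul, add_mul, mul_assoc, hA, mul_one, mul_assoc, mul_assoc, hA, mul_one]
    abel
  rw [e]
  exact norm_centralResponseC_sub_le (IsCentral c) (fun i => loopMh W c i) (fun i hc => loopMh_of_isCentral W hW c i hc) hα0 hα hloop Y

end Summit.QuantumFields.YangMills.Theorems.BalabanUVNodesPortS1

end
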